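import Literature.NumberTheory.Transcendental.CurvePeriodsGmPathsProofs
import Literature.NumberTheory.Transcendental.CurvePeriodsAffineLineProofs
import Literature.NumberTheory.Transcendental.CurvePeriodsTransportProofs
import Literature.NumberTheory.Transcendental.BakerLogarithmsConclusion
import HarnessLib

/-!
# Periods of curve type: Huber–Wüstholz 13.3 (2) for `𝔾ₘ` and `𝔸¹` is Baker's theorem

Companion of `Literature/NumberTheory/Transcendental/CurvePeriods.lean` (Huber–Wüstholz 2022,
Thm. 13.3 (2), rendered on explicit period symbols with the elementary relations (R1)–(R5)).
The periods of the symbols on `𝔾ₘ = {xy = 1}` (arbitrary `C¹` paths with algebraic end points)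
and on `𝔸¹` are the `ℚ̄`-combinations of `1` and of logarithms of algebraic numbers, and the book
remarks (Rem. 15.11, p. 151 of the held text; §10.1) that the period conjecture for these
1-motives `[ℤʳ → 𝔾ₘˢ]` "is precisely Baker's Theorem". Baker's theorem is PROVED in this tree
(`Literature.NumberTheory.Transcendental.baker_holds`, Baker 1975, Thm. 2.1); this file deduces
from it the corresponding case of the named fact `HuberWustholzCurvePeriods`:

* `huberWustholzCurvePeriods_of_mulGroup_affineLine` — a vanishing `ℚ̄`-linear combination of
  period symbols on `𝔾ₘ` and `𝔸¹` is a `ℚ̄`-linear combination of elementary relations.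

Steps: every symbol is, modulo the `ℚ̄`-span of the relations, `d · ℓ(M) + e · 𝟙` with
`d, e ∈ ℚ̄` and `ℓ(M) = (𝔾ₘ, y dx, E_{0,M})` a logarithm symbol, `e^M ∈ ℚ̄`
(`exists_logSym_rel`: residue reduction (R1–R3), homotopy to an exponential path (R5), base
change (R4), `CurvePeriodsGmPathsProofs.lean`); the logarithm symbols are `ℚ`-linear in `M`
(`span_logSym_sum`), so after choosing a `ℚ`-basis of the `ℚ`-span of the `M`'s the combination
is `Σ D_m ℓ(m) + e 𝟙` with `ℚ`-independent logarithms `m` of algebraic numbers; its period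
`Σ D_m m + e` vanishes, and Baker's theorem forces `D_m = e = 0`.

## References

* A. Huber, G. Wüstholz, *Transcendence and Linear Relations of 1-Periods*, Cambridge Tracts in
  Mathematics 227, CUP 2022 [HuberWustholz2022], Thm. 13.3 (2) (p. 121), §10.1 (p. 96),
  Rem. 15.11 (p. 151).
* A. Baker, *Transcendental Number Theory*, CUP 1975, Thm. 2.1 (vendored and proved as
  `Literature.NumberTheory.Transcendental.baker_holds`).
-/

noncomputable section

open scoped BigOperators Real
open MvPolynomial Set Complex

namespace Literature.NumberTheory.Transcendental

namespace CurvePeriods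

section Baker

local notation3 "InSpanRel " c:arg => ∃ (k : ℕ) (ρ : Fin k → (PeriodSymbol →₀ ℂ))
  (a : Fin k → ℂ), (∀ l, IsElementaryRelation (ρ l)) ∧ (∀ l, IsAlgebraic ℚ (a l)) ∧
    c = ∑ l, a l • ρ l

local notation3 "logSym " E:arg => (⟨⟨2, 1, ![X 0 * X 1 - 1]⟩, isSmoothAffineCurve_mulGroup,
  ![X 1, 0], hasAlgCoeffs_ydx, E⟩ : PeriodSymbol)

/-! ### Every symbol on `𝔾ₘ` or `𝔸¹` is `d · ℓ(M) + e · 𝟙` modulo relations -/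

/-- Residue reduction for an arbitrary path on `𝔾ₘ`: `(𝔾ₘ, ω, γ) − α(𝔾ₘ, y dx, γ) − β · 𝟙` lies in
the `ℚ̄`-span of the elementary relations, with `α` the residue of `ω` and
`β = P(γ(1)) − P(γ(0))` for the primitive part `dP` ((R1), (R1b), (R3), (R2)). [folklore] -/
theorem span_single_sub_smul_ydx_sub_unit (ω : Fin 2 → MvPolynomial (Fin 2) ℂ)
    (h : ∀ i, HasAlgCoeffs (ω i)) (γ : CurvePath (⟨2, 1, ![X 0 * X 1 - 1]⟩ : CurveData)) :
    ∃ α β : ℂ, IsAlgebraic ℚ α ∧ IsAlgebraic ℚ β ∧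
      InSpanRel (Finsupp.single (⟨⟨2, 1, ![X 0 * X 1 - 1]⟩, isSmoothAffineCurve_mulGroup, ω, h, γ⟩ :
          PeriodSymbol) (1 : ℂ) - α • Finsupp.single (logSym γ) (1 : ℂ) -
          β • Finsupp.single PeriodSymbol.unit (1 : ℂ)) := by
  have hG := isSmoothAffineCurve_mulGroup
  obtain ⟨α, P, ν, hα, hP, hν, hv, he⟩ := exists_reduction_form ω h
  refine ⟨α, eval (γ.toFun 1) P - eval (γ.toFun 0) P, hα,
    (hP.isAlgebraic_eval γ.algebraic_one).sub (hP.isAlgebraic_eval γ.algebraic_zero), ?_⟩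
  have hαy : ∀ i, HasAlgCoeffs ((α • (![X 1, 0] : Fin 2 → MvPolynomial (Fin 2) ℂ)) i) :=
    fun i => (hasAlgCoeffs_ydx i).smul hα
  have hdP : ∀ i, HasAlgCoeffs (formD P i) := hP.formD
  have h₂alg : ∀ i, HasAlgCoeffs ((α • (![X 1, 0] : Fin 2 → MvPolynomial (Fin 2) ℂ) +
      formD P) i) := fun i => (hαy i).add (hdP i)
  have h₃alg : ∀ i, HasAlgCoeffs ((α • (![X 1, 0] : Fin 2 → MvPolynomial (Fin 2) ℂ) +
      formD P + ν) i) := fun i => (h₂alg i).add (hν i)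
  have r₁ := IsElementaryRelation.add _ hG γ _ _ _ h₃alg h₂alg hν rfl
  have r₂ := IsElementaryRelation.add _ hG γ _ _ _ h₂alg hαy hdP rfl
  have r₃ := IsElementaryRelation.smul _ hG γ α hα ![X 1, 0] _ hasAlgCoeffs_ydx hαy rfl
  have r₄ := IsElementaryRelation.exact _ hG γ P hP _ hdP rfl
  have r₅ := IsElementaryRelation.vanish _ hG γ ν hν hv
  obtain ⟨k, ρ, a, hρ, ha, hsum⟩ := span_add (span_add (span_add (span_add (span_of_rel r₁)
    (span_of_rel r₂)) (span_of_rel r₃)) (span_of_rel r₄)) (span_of_rel r₅)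
  refine ⟨k, ρ, a, hρ, ha, ?_⟩
  rw [PeriodSymbol.mk_eq_mk hG h h₃alg γ he, ← hsum]
  abel

/-- **Every symbol on `𝔾ₘ` or on `𝔸¹` is `d · ℓ(M) + e · 𝟙` modulo the elementary relations**,
with `d, e ∈ ℚ̄`, `e^M ∈ ℚ̄` and `ℓ(M) = (𝔾ₘ, y dx, E_{0,M})`. [folklore] -/
theorem exists_logSym_rel (s : PeriodSymbol)
    (hs : s.Z = (⟨2, 1, ![X 0 * X 1 - 1]⟩ : CurveData) ∨ s.Z = CurveData.affineLine) :
    ∃ (M : ℂ) (E : CurvePath (⟨2, 1, ![X 0 * X 1 - 1]⟩ : CurveData)) (d e : ℂ),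
      IsAlgebraic ℚ (exp M) ∧
      (∀ t, E.toFun t = ![exp ((1 - t) * 0 + t * M), exp (-((1 - t) * 0 + t * M))]) ∧
      IsAlgebraic ℚ d ∧ IsAlgebraic ℚ e ∧
      InSpanRel (Finsupp.single s (1 : ℂ) - d • Finsupp.single (logSym E) (1 : ℂ) -
        e • Finsupp.single PeriodSymbol.unit (1 : ℂ)) := by
  rcases hs with hs | hs
  · obtain ⟨Z, hZ, ω, hω, γ⟩ := s
    dsimp only at hs
    subst hs
    obtain ⟨α, β, hα, hβ, h₁⟩ := span_single_sub_smul_ydx_sub_unit ω hω γ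
    obtain ⟨L₀, L₁, E', ρ₁, ρ₂, ρ₃, ρ₄, hL₀, hL₁, hE', hr₁, hr₂, hr₃, hr₄, he⟩ :=
      exists_single_path_eq_single_expPath ![X 1, 0] hasAlgCoeffs_ydx γ
    have h₀alg : IsAlgebraic ℚ (exp L₀) := hL₀ ▸ γ.algebraic_zero 0
    have h₁alg : IsAlgebraic ℚ (exp L₁) := hL₁ ▸ γ.algebraic_one 0
    have hMalg : IsAlgebraic ℚ (exp (L₁ - L₀)) := by
      rw [exp_sub]; exact h₁alg.mul h₀alg.inv
    obtain ⟨E, hE⟩ := exists_expPath (L₀ := 0) (L₁ := L₁ - L₀) isAlgebraic_exp_zero hMalg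
    have h₃ := rel_expPath_baseChange h₀alg E' E hE' hE
    refine ⟨L₁ - L₀, E, α, β, hMalg, hE, hα, hβ, ?_⟩
    have h₂ : InSpanRel (Finsupp.single (logSym γ) (1 : ℂ) - Finsupp.single (logSym E') 1) := by
      obtain ⟨k, ρ, a, hρ, ha, hsum⟩ := span_sub (span_sub (span_add (span_of_rel hr₃)
        (span_of_rel hr₄)) (span_of_rel hr₁)) (span_of_rel hr₂)
      exact ⟨k, ρ, a, hρ, ha, by rw [he, ← hsum]; abel⟩
    obtain ⟨k, ρ, a, hρ, ha, hsum⟩ := span_add h₁ (span_smul hα (span_add h₂ (span_of_rel h₃)))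
    exact ⟨k, ρ, a, hρ, ha, by rw [← hsum, smul_add, smul_sub, smul_sub]; abel⟩
  · obtain ⟨π₀, hπ₀, _, hrel⟩ := exists_rel_of_affineLine s hs
    obtain ⟨E, hE⟩ := exists_expPath (L₀ := 0) (L₁ := 0) isAlgebraic_exp_zero isAlgebraic_exp_zero
    refine ⟨0, E, 0, π₀, isAlgebraic_exp_zero, hE, isAlgebraic_zero, hπ₀, ?_⟩
    obtain ⟨k, ρ, a, hρ, ha, hsum⟩ := span_of_rel hrel
    exact ⟨k, ρ, a, hρ, ha, by rw [← hsum, zero_smul, sub_zero]⟩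

/-! ### Logarithm symbols of rational combinations -/

/-- `e^{Σ qᵢ mᵢ}` is algebraic when the `e^{mᵢ}` are and `qᵢ ∈ ℚ`. [folklore] -/
theorem isAlgebraic_exp_sum_rat_mul {ι : Type*} (T : Finset ι) (m : ι → ℂ)
    (hm : ∀ i, IsAlgebraic ℚ (exp (m i))) (q : ι → ℚ) :
    IsAlgebraic ℚ (exp (∑ i ∈ T, (q i : ℂ) * m i)) := by
  classical
  induction T using Finset.induction_on with
  | empty => simpa using isAlgebraic_exp_zero
  | insert i T hi ih =>
    rw [Finset.sum_insert hi, exp_add]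
    exact (isAlgebraic_exp_rat_mul (hm i) (q i)).mul ih

/-- **`ℓ(Σ qᵢ mᵢ) ∼ Σ qᵢ ℓ(mᵢ)`** for `qᵢ ∈ ℚ` (additivity and `ℚ`-linearity of the logarithm
symbols). [folklore] -/
theorem span_logSym_sum {ι : Type*} (T : Finset ι) (m : ι → ℂ)
    (hm : ∀ i, IsAlgebraic ℚ (exp (m i))) (q : ι → ℚ)
    (Em : ι → CurvePath (⟨2, 1, ![X 0 * X 1 - 1]⟩ : CurveData))
    (hEm : ∀ i t, (Em i).toFun t =
      ![exp ((1 - t) * 0 + t * m i), exp (-((1 - t) * 0 + t * m i))])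
    (E : CurvePath (⟨2, 1, ![X 0 * X 1 - 1]⟩ : CurveData))
    (hE : ∀ t, E.toFun t = ![exp ((1 - t) * 0 + t * (∑ i ∈ T, (q i : ℂ) * m i)),
      exp (-((1 - t) * 0 + t * (∑ i ∈ T, (q i : ℂ) * m i)))]) :
    InSpanRel (Finsupp.single (logSym E) (1 : ℂ) -
      ∑ i ∈ T, (q i : ℂ) • Finsupp.single (logSym (Em i)) (1 : ℂ)) := by
  classical
  induction T using Finset.induction_on generalizing E with
  | empty =>
    have hE' : ∀ t, E.toFun t = ![exp ((1 - t) * 0 + t * 0), exp (-((1 - t) * 0 + t * 0))] :=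
      fun t => by rw [hE, Finset.sum_empty]
    obtain ⟨k, ρ, a, hρ, ha, he⟩ := span_of_rel (rel_logSym_zero E hE')
    exact ⟨k, ρ, a, hρ, ha, by rw [← he, Finset.sum_empty, sub_zero]⟩
  | insert i T hi ih =>
    -- paths for `qᵢ mᵢ` and for the remaining sum
    obtain ⟨EA, hEA⟩ := exists_expPath (L₀ := 0) (L₁ := (q i : ℂ) * m i) isAlgebraic_exp_zero
      (isAlgebraic_exp_rat_mul (hm i) (q i))
    obtain ⟨EB, hEB⟩ := exists_expPath (L₀ := 0) (L₁ := ∑ j ∈ T, (q j : ℂ) * m j)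
      isAlgebraic_exp_zero (isAlgebraic_exp_sum_rat_mul T m hm q)
    have hE' : ∀ t, E.toFun t = ![exp ((1 - t) * 0 + t * ((q i : ℂ) * m i +
        ∑ j ∈ T, (q j : ℂ) * m j)), exp (-((1 - t) * 0 + t * ((q i : ℂ) * m i +
        ∑ j ∈ T, (q j : ℂ) * m j)))] := fun t => by rw [hE, Finset.sum_insert hi]
    have hadd := span_logSym_add (isAlgebraic_exp_rat_mul (hm i) (q i))
      (isAlgebraic_exp_sum_rat_mul T m hm q) EA EB E hEA hEB hE'
    have hrat := span_logSym_ratMul (hm i) (q i) (Em i) EA (hEm i) hEA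
    have hih := ih EB hEB
    obtain ⟨k, ρ, a, hρ, ha, he⟩ :=
      span_add (span_add (span_smul isAlgebraic_one.neg hadd) hrat) hih
    refine ⟨k, ρ, a, hρ, ha, ?_⟩
    rw [← he, Finset.sum_insert hi, neg_one_smul]
    abel

/-! ### Evaluation of finite sums -/

/-- `evalCombination` of a finite sum. [folklore] -/
theorem evalCombination_finsetSum {ι : Type*} (T : Finset ι) (f : ι → (PeriodSymbol →₀ ℂ)) :
    evalCombination (∑ i ∈ T, f i) = ∑ i ∈ T, evalCombination (f i) := by
  classical
  induction T using Finset.induction_on with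
  | empty => simp [evalCombination]
  | insert i T hi ih => rw [Finset.sum_insert hi, Finset.sum_insert hi, evalCombination_add, ih]

/-! ### The theorem -/

/-- **Huber–Wüstholz, Theorem 13.3 (2), for `𝔾ₘ` and `𝔸¹` — from Baker's theorem.** A vanishing
`ℚ̄`-linear combination of period symbols `(𝔾ₘ, ω, γ)` (`𝔾ₘ = {xy = 1} ⊂ 𝔸²`, `γ` any `C¹` path
with algebraic end points) and `(𝔸¹, ω, γ)` is a `ℚ̄`-linear combination of elementary
relations (R1)–(R5). The periods in question are the `ℚ̄`-combinations of `1` and of logarithms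
of algebraic numbers; the only transcendence input is Baker's theorem
`Literature.NumberTheory.Transcendental.baker_holds` (proved in the tree), exactly as the book
says for the 1-motives `[ℤʳ → 𝔾ₘˢ]` (Rem. 15.11: "This is precisely Baker's Theorem").
[cite: HuberWustholz2022, Thm. 13.3 (2) (p. 121), Rem. 15.11 (p. 151), §10.1 (p. 96)] -/
theorem huberWustholzCurvePeriods_of_mulGroup_affineLine (c : PeriodSymbol →₀ ℂ)
    (hc : ∀ s, IsAlgebraic ℚ (c s))
    (hsupp : ∀ s ∈ c.support,
      s.Z = (⟨2, 1, ![X 0 * X 1 - 1]⟩ : CurveData) ∨ s.Z = CurveData.affineLine)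
    (h0 : evalCombination c = 0) :
    ∃ (k : ℕ) (ρ : Fin k → (PeriodSymbol →₀ ℂ)) (a : Fin k → ℂ),
      (∀ l, IsElementaryRelation (ρ l)) ∧ (∀ l, IsAlgebraic ℚ (a l)) ∧ c = ∑ l, a l • ρ l := by
  classical
  obtain ⟨E00, hE00⟩ := exists_expPath (L₀ := 0) (L₁ := 0) isAlgebraic_exp_zero isAlgebraic_exp_zero
  -- Step 1: every symbol of `c` is `d_s ℓ(M_s) + e_s 𝟙` modulo relations
  have key : ∀ s : PeriodSymbol, ∃ (M : ℂ) (E : CurvePath (⟨2, 1, ![X 0 * X 1 - 1]⟩ : CurveData))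
      (d e : ℂ), s ∈ c.support →
      (IsAlgebraic ℚ (exp M) ∧
        (∀ t, E.toFun t = ![exp ((1 - t) * 0 + t * M), exp (-((1 - t) * 0 + t * M))]) ∧
        IsAlgebraic ℚ d ∧ IsAlgebraic ℚ e ∧
        InSpanRel (Finsupp.single s (1 : ℂ) - d • Finsupp.single (logSym E) (1 : ℂ) -
          e • Finsupp.single PeriodSymbol.unit (1 : ℂ))) := by
    intro s
    by_cases hs : s ∈ c.support
    · obtain ⟨M, E, d, e, h1, h2, h3, h4, h5⟩ := exists_logSym_rel s (hsupp s hs)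
      exact ⟨M, E, d, e, fun _ => ⟨h1, h2, h3, h4, h5⟩⟩
    · exact ⟨0, E00, 0, 0, fun h => (hs h).elim⟩
  choose M E d e hkey using key
  -- Step 2: a `ℚ`-basis of the `ℚ`-span of the logarithms `M_s`
  set S : Finset ℂ := c.support.image M with hS
  obtain ⟨b, hbS, hspan, hli⟩ := exists_linearIndependent ℚ (↑S : Set ℂ)
  have hbfin : b.Finite := S.finite_toSet.subset hbS
  set B : Finset ℂ := hbfin.toFinset with hB
  have hBb : (↑B : Set ℂ) = b := hbfin.coe_toFinset
  have halgB : ∀ m : B, IsAlgebraic ℚ (exp (m : ℂ)) := by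
    rintro ⟨m, hm⟩
    have hm' : m ∈ S := by
      have : m ∈ b := by rw [← hBb]; exact hm
      exact hbS this
    obtain ⟨s, hs, rfl⟩ := Finset.mem_image.1 hm'
    exact (hkey s hs).1
  have hliB : LinearIndependent ℚ (fun m : B => (m : ℂ)) := by
    rw [← hBb] at hli
    exact hli
  -- paths for the basis logarithms
  have keyB : ∀ m : B, ∃ Em : CurvePath (⟨2, 1, ![X 0 * X 1 - 1]⟩ : CurveData),
      ∀ t, Em.toFun t = ![exp ((1 - t) * 0 + t * (m : ℂ)), exp (-((1 - t) * 0 + t * (m : ℂ)))] :=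
    fun m => exists_expPath (L₀ := 0) (L₁ := (m : ℂ)) isAlgebraic_exp_zero (halgB m)
  choose Em hEm using keyB
  -- Step 3: rational coordinates of each `M_s` in the basis
  have keyq : ∀ s : PeriodSymbol, ∃ q : B → ℚ, s ∈ c.support →
      ∑ i, (q i : ℂ) * (i : ℂ) = M s := by
    intro s
    by_cases hs : s ∈ c.support
    · have hmem : M s ∈ Submodule.span ℚ (Set.range fun m : B => (m : ℂ)) := by
        have hrange : Set.range (fun m : B => (m : ℂ)) = (↑B : Set ℂ) := Subtype.range_coe
        rw [hrange, hBb, hspan]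
        exact Submodule.subset_span (Finset.mem_coe.2 (Finset.mem_image_of_mem M hs))
      obtain ⟨q, hq⟩ := (Submodule.mem_span_range_iff_exists_fun ℚ).1 hmem
      refine ⟨q, fun _ => ?_⟩
      rw [← hq]
      exact Finset.sum_congr rfl fun i _ => by rw [Rat.smul_def]
    · exact ⟨0, fun h => (hs h).elim⟩
  choose q hq using keyq
  -- Step 4: per symbol, `s ∼ Σ_i (d_s q_{s,i}) ℓ(i) + e_s 𝟙`
  have hper_s : ∀ s ∈ c.support, InSpanRel (Finsupp.single s (1 : ℂ) -
      d s • ∑ i : B, (q s i : ℂ) • Finsupp.single (logSym (Em i)) (1 : ℂ) -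
      e s • Finsupp.single PeriodSymbol.unit (1 : ℂ)) := by
    intro s hs
    obtain ⟨_, hEs, hds, _, hrel⟩ := hkey s hs
    have hsum := span_logSym_sum (Finset.univ : Finset B) (fun m : B => (m : ℂ)) halgB (q s) Em
      (fun i t => hEm i t) (E s) (fun t => by rw [hEs, hq s hs])
    obtain ⟨k, ρ, a, hρ, ha, he⟩ := span_add hrel (span_smul hds hsum)
    exact ⟨k, ρ, a, hρ, ha, by rw [← he, smul_sub]; abel⟩
  -- Step 5: sum over the support
  have hspan : ∀ T : Finset PeriodSymbol, T ⊆ c.support →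
      InSpanRel (∑ s ∈ T, c s • (Finsupp.single s (1 : ℂ) -
        d s • ∑ i : B, (q s i : ℂ) • Finsupp.single (logSym (Em i)) (1 : ℂ) -
        e s • Finsupp.single PeriodSymbol.unit (1 : ℂ))) := by
    intro T hT
    induction T using Finset.induction_on with
    | empty => simpa using span_zero
    | insert s T hs ih =>
      rw [Finset.sum_insert hs]
      exact span_add (span_smul (hc s) (hper_s s (hT (Finset.mem_insert_self s T))))
        (ih (subset_trans (Finset.subset_insert s T) hT))
  obtain ⟨k, ρ, a, hρ, ha, hmain⟩ := hspan c.support subset_rfl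
  -- the subtracted element `W = Σ_i D_i ℓ(i) + e_tot 𝟙`
  set D : B → ℂ := fun i => ∑ s ∈ c.support, c s * d s * (q s i : ℂ) with hD
  set etot : ℂ := ∑ s ∈ c.support, c s * e s with hetot
  have hc_eq : c = ∑ s ∈ c.support, c s • Finsupp.single s (1 : ℂ) := by
    conv_lhs => rw [← Finsupp.sum_single c]
    simp only [Finsupp.sum, Finsupp.smul_single_one]
  have hident : ∑ s ∈ c.support, c s • (Finsupp.single s (1 : ℂ) -
        d s • ∑ i : B, (q s i : ℂ) • Finsupp.single (logSym (Em i)) (1 : ℂ) -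
        e s • Finsupp.single PeriodSymbol.unit (1 : ℂ)) =
      c - (∑ i : B, D i • Finsupp.single (logSym (Em i)) (1 : ℂ) +
        etot • Finsupp.single PeriodSymbol.unit (1 : ℂ)) := by
    have e1 : ∀ s, c s • (Finsupp.single s (1 : ℂ) -
        d s • ∑ i : B, (q s i : ℂ) • Finsupp.single (logSym (Em i)) (1 : ℂ) -
        e s • Finsupp.single PeriodSymbol.unit (1 : ℂ)) =
        c s • Finsupp.single s (1 : ℂ) -
          ∑ i : B, (c s * d s * (q s i : ℂ)) • Finsupp.single (logSym (Em i)) (1 : ℂ) -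
          (c s * e s) • Finsupp.single PeriodSymbol.unit (1 : ℂ) := by
      intro s
      rw [smul_sub, smul_sub, smul_smul, Finset.smul_sum, smul_smul]
      congr 2
      exact Finset.sum_congr rfl fun i _ => by rw [smul_smul]
    simp_rw [e1]
    rw [Finset.sum_sub_distrib, Finset.sum_sub_distrib, ← hc_eq, Finset.sum_comm, hD, hetot,
      Finset.sum_smul]
    simp_rw [Finset.sum_smul]
    abel
  rw [hident] at hmain
  -- Step 6: the period of `W` vanishes: `Σ_i D_i · i + e_tot = 0`
  have hevW : ∑ i : B, D i * (i : ℂ) + etot = 0 := by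
    have h1 := evalCombination_eq_zero_of_isElementaryRelation ρ a hρ
    rw [← hmain, sub_eq_add_neg, evalCombination_add, h0, zero_add, ← neg_one_smul ℂ,
      evalCombination_smul, evalCombination_add, evalCombination_finsetSum,
      evalCombination_smul, evalCombination_single, period_unit] at h1
    have h2 : ∀ i : B, evalCombination (D i • Finsupp.single (logSym (Em i)) (1 : ℂ)) =
        D i * (i : ℂ) := fun i => by
      rw [evalCombination_smul, evalCombination_single, period_ydx_expPath 0 (i : ℂ) (Em i)
        (hEm i), sub_zero, one_mul]
    simp_rw [h2] at h1
    have h3 : (∑ i : B, D i * (i : ℂ)) + etot * (1 * 1) = 0 := by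
      have := h1
      rw [neg_one_mul, neg_eq_zero] at this
      exact this
    simpa using h3
  -- Step 7: Baker's theorem
  have hBk := baker_holds (fun m : B => (m : ℂ)) halgB hliB
  have memK : ∀ x : ℂ, IsAlgebraic ℚ x → x ∈ algebraicClosure ℚ ℂ := fun x hx =>
    mem_algebraicClosure_iff.mpr hx
  have hqalg : ∀ s (i : B), IsAlgebraic ℚ ((q s i : ℚ) : ℂ) := fun s i => by
    simpa using isAlgebraic_algebraMap (R := ℚ) (A := ℂ) (q s i)
  have hDalg : ∀ i, IsAlgebraic ℚ (D i) := fun i =>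
    isAlgebraic_finsetSum _ _ fun s hs => ((hc s).mul (hkey s hs).2.2.1).mul (hqalg s i)
  have hetalg : IsAlgebraic ℚ etot :=
    isAlgebraic_finsetSum _ _ fun s hs => (hc s).mul (hkey s hs).2.2.2.1
  let g : Option B → algebraicClosure ℚ ℂ := fun o =>
    o.elim ⟨etot, memK _ hetalg⟩ (fun i => ⟨D i, memK _ (hDalg i)⟩)
  have hg : ∑ o, g o • (o.elim (1 : ℂ) (fun m : B => (m : ℂ)) : ℂ) = 0 := by
    rw [Fintype.sum_option]
    simp only [g, Option.elim, IntermediateField.smul_def, smul_eq_mul, mul_one]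
    rw [add_comm]
    simpa using hevW
  have hg0 := Fintype.linearIndependent_iff.mp hBk g hg
  have hD0 : ∀ i, D i = 0 := fun i => by
    have h := congrArg (fun w : algebraicClosure ℚ ℂ => (w : ℂ)) (hg0 (some i))
    simpa [g] using h
  have het0 : etot = 0 := by
    have h := congrArg (fun w : algebraicClosure ℚ ℂ => (w : ℂ)) (hg0 none)
    simpa [g] using h
  -- Step 8: conclude
  refine ⟨k, ρ, a, hρ, ha, ?_⟩
  rw [← hmain]
  simp [hD0, het0]

/-- **… and for every curve polynomially isomorphic to `𝔾ₘ` or to `𝔸¹`** (arbitrary `C¹` paths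
with algebraic end points; e.g. hyperbolas `xy = a`, the circle `x² + y² = 1`, lines, graphs of
polynomials): transport along the isomorphism by (R4) (`exists_transport`), then
`huberWustholzCurvePeriods_of_mulGroup_affineLine`.
[cite: HuberWustholz2022, Thm. 13.3 (2) (p. 121), Rem. 15.11 (p. 151)] -/
theorem huberWustholzCurvePeriods_of_iso_mulGroup_affineLine (c : PeriodSymbol →₀ ℂ)
    (hc : ∀ s, IsAlgebraic ℚ (c s))
    (hiso : ∀ s ∈ c.support,
      (∃ (φ : Fin s.Z.n → MvPolynomial (Fin 2) ℂ) (ψ : Fin 2 → MvPolynomial (Fin s.Z.n) ℂ),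
        (∀ j, HasAlgCoeffs (φ j)) ∧ (∀ i, HasAlgCoeffs (ψ i)) ∧
          (∀ x ∈ (⟨2, 1, ![X 0 * X 1 - 1]⟩ : CurveData).points,
            (fun j => eval x (φ j)) ∈ s.Z.points) ∧
          (∀ z ∈ s.Z.points,
            (fun i => eval z (ψ i)) ∈ (⟨2, 1, ![X 0 * X 1 - 1]⟩ : CurveData).points) ∧
          (∀ z ∈ s.Z.points, (fun j => eval (fun i => eval z (ψ i)) (φ j)) = z)) ∨
      (∃ (φ : Fin s.Z.n → MvPolynomial (Fin 1) ℂ) (ψ : Fin 1 → MvPolynomial (Fin s.Z.n) ℂ),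
        (∀ j, HasAlgCoeffs (φ j)) ∧ (∀ i, HasAlgCoeffs (ψ i)) ∧
          (∀ x : Fin 1 → ℂ, (fun j => eval x (φ j)) ∈ s.Z.points) ∧
          (∀ z ∈ s.Z.points, (fun j => eval (fun i => eval z (ψ i)) (φ j)) = z)))
    (h0 : evalCombination c = 0) :
    ∃ (k : ℕ) (ρ : Fin k → (PeriodSymbol →₀ ℂ)) (a : Fin k → ℂ),
      (∀ l, IsElementaryRelation (ρ l)) ∧ (∀ l, IsAlgebraic ℚ (a l)) ∧ c = ∑ l, a l • ρ l := by
  classical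
  have key : ∀ s : PeriodSymbol, ∃ s₁ : PeriodSymbol, s ∈ c.support →
      ((s₁.Z = (⟨2, 1, ![X 0 * X 1 - 1]⟩ : CurveData) ∨ s₁.Z = CurveData.affineLine) ∧
        IsElementaryRelation (Finsupp.single s₁ 1 - Finsupp.single s 1)) := by
    intro s
    by_cases hs : s ∈ c.support
    · rcases hiso s hs with ⟨φ, ψ, hφ, hψ, hφZ, hψZ, hinv⟩ | ⟨φ, ψ, hφ, hψ, hφZ, hinv⟩
      · obtain ⟨γ, _, hrel⟩ := exists_transport isSmoothAffineCurve_mulGroup s.smooth φ hφ hφZ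
          ψ hψ hψZ hinv s.ω s.ω_algebraic s.γ
        exact ⟨_, fun _ => ⟨Or.inl rfl, hrel⟩⟩
      · obtain ⟨γ, _, hrel⟩ := exists_transport CurveData.isSmoothAffineCurve_affineLine s.smooth
          φ hφ (fun x _ => hφZ x) ψ hψ (fun z' _ => by simp) hinv s.ω s.ω_algebraic s.γ
        exact ⟨_, fun _ => ⟨Or.inr rfl, hrel⟩⟩
    · exact ⟨s, fun h => (hs h).elim⟩
  choose T hT using key
  exact span_of_transfer c hc T (fun s hs => (hT s hs).2)
    (fun s => s.Z = (⟨2, 1, ![X 0 * X 1 - 1]⟩ : CurveData) ∨ s.Z = CurveData.affineLine)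
    (fun s hs => (hT s hs).1)
    (fun c' hc' hsupp h0' => huberWustholzCurvePeriods_of_mulGroup_affineLine c' hc' hsupp h0')
    h0

end Baker

end CurvePeriods

end Literature.NumberTheory.Transcendental

end
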